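import Mathlib
import Literature.AlgebraicGeometry.Tropical.TorusCycles
import Summits.HodgeConjecture.HodgeConjecture.Theorems.TropicalWeilObstructionTropicalWeilVanishingSplitPointPhase
import HarnessLib

/-!
# Crux `TropicalWeilVanishing` (stmt-HodgeConjecture-18478) — the PHASE of the pure-wall germ:
# `η = det U · (1 − i)ⁿ`, `η² ∈ ℝ · (−2i)ⁿ`

Route `TropicalWeilObstruction` of `HodgeConjecture`; cell `pub-hodge-tropical` (Hodge NEGATION SINK —
scoped exploration, no summit claim). HONEST FRAMING: a bookkeeping corollary of tropical-1 gen 11's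
phase law (`SplitPoint.frameComplexDet_eq_real_mul_prod`, p367366) for the cells of the pure-wall germ
of tropical-1 gen 12 (`SplitGerm.normSq_eq_normSq_wallPair_of_mem_germ`, p368559); it decides nothing
about K1 (`TropicalWeilVanishing`, OPEN) or K1_∂ and nothing here bears on the Hodge conjecture.

On the germ plane `𝒜_w = {A(u+v−w) = B(u−v+w)}` every coordinate odd divisor is tied; at the split
point `B = 0` it is the antidiagonal graph `u + v = w`, whose lattice directions are `{(a | −a)}`. A
germ cell therefore has a frame `L = (U | −U)ᵀ` (top block an integer `n × n` matrix `U`, bottom block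
`−U`), and the phase law with `M = 1`, `p = q = 1`, `T = U` gives `η(L) = det U · (1 − i)ⁿ`
(`frameComplexDet_antidiagonal`). Hence `η(L)² = (det U)² · (−2i)ⁿ` (`sq_frameComplexDet_antidiagonal`):
the germ cells are CALIBRATED with `η²`-phase `(−2i)ⁿ/|…|`, i.e. `−1` at `n = 2` (van Geemen's 76 bulk
cells, `W = −μ`), `+i` at `n = 3`, `+1` at `n = 4`, `−i` at `n = 5`, … (`neg_two_mul_I_pow_two/three/
four`) — the phases recorded in K1-SCOPE §8b (2)/(5) and HOME `certificates/splitgerms/README` §3, §9b,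
and re-derived by hand in the referee verdicts of tropical-2 gens 11–12. negation-sink work.

Mathlib + the two tree files named; no definition, no named fact, no sorry.

## References

* [Zharkov2020TropicalWeil] I. Zharkov, Tropical abelian varieties, Weil classes and the Hodge
  conjecture, arXiv:2002.02347 (2020), §2 (pp. 2–4) (`η`, the Weil functional, calibrated cycles).
* [MikhalkinZharkov2014Eigenwave] G. Mikhalkin, I. Zharkov, Tropical eigenwave and intermediate
  Jacobians, LN UMI 15 (2014), §5 (tropical theta divisors).
-/

-- `Summit.HodgeConjecture.HodgeConjecture.…` is the mandated namespace (single-conjunct summit).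
set_option linter.dupNamespace false

noncomputable section

open scoped BigOperators Matrix
open Matrix Literature.AlgebraicGeometry.Tropical

namespace Summit.HodgeConjecture.HodgeConjecture.Theorems.TropicalWeilVanishing.SplitGerm

variable {n : ℕ}

/-- **Phase of an antidiagonal frame (the pure-wall germ cells).** If the integer `2n × n` frame `L`
has top block `U` and bottom block `−U` — a lattice frame of the antidiagonal plane `{(a | −a)}`, the
direction space of the pure-wall germ at the split point — then `η(L) = det U · (1 − i)ⁿ`. Corollary of
the phase law `SplitPoint.frameComplexDet_eq_real_mul_prod` with `M = 1`, `p = q = 1`, `T = U`.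
[cite: Zharkov2020TropicalWeil, §2 (pp. 2–4)] -/
theorem frameComplexDet_antidiagonal (L : Matrix (Fin (2 * n)) (Fin n) ℤ) (U : Matrix (Fin n) (Fin n) ℝ)
    (hx : ∀ k j : Fin n, ((L ⟨(k : ℕ), by omega⟩ j : ℤ) : ℝ) = U k j)
    (hy : ∀ k j : Fin n, ((L ⟨(k : ℕ) + n, by omega⟩ j : ℤ) : ℝ) = -U k j) :
    frameComplexDet n L = ((U.det : ℝ) : ℂ) * (1 - Complex.I) ^ n := by
  classical
  have h1 : (1 : Matrix (Fin n) (Fin n) ℝ).det ≠ 0 := by simp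
  have hx' : ∀ k j, ∑ a : Fin n, (1 : Matrix (Fin n) (Fin n) ℝ) k a *
      ((L ⟨(a : ℕ), by omega⟩ j : ℤ) : ℝ) = (fun _ : Fin n => (1 : ℝ)) k * U k j := by
    intro k j
    rw [Finset.sum_eq_single k]
    · rw [Matrix.one_apply_eq, one_mul, hx, one_mul]
    · intro a _ hak; rw [Matrix.one_apply_ne' hak, zero_mul]
    · intro h; exact absurd (Finset.mem_univ k) h
  have hy' : ∀ k j, ∑ a : Fin n, (1 : Matrix (Fin n) (Fin n) ℝ) k a *
      ((L ⟨(a : ℕ) + n, by omega⟩ j : ℤ) : ℝ) = -((fun _ : Fin n => (1 : ℝ)) k * U k j) := by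
    intro k j
    rw [Finset.sum_eq_single k]
    · rw [Matrix.one_apply_eq, one_mul, hy, one_mul]
    · intro a _ hak; rw [Matrix.one_apply_ne' hak, zero_mul]
    · intro h; exact absurd (Finset.mem_univ k) h
  have h := SplitPoint.frameComplexDet_eq_real_mul_prod L 1 U h1 (fun _ => (1 : ℝ)) (fun _ => (1 : ℝ))
    hx' hy'
  rw [h, Matrix.det_one, div_one, Finset.prod_const, Finset.card_univ, Fintype.card_fin]
  push_cast
  ring

/-- `(1 − i)² = −2i`. [folklore] -/
theorem one_sub_I_sq : (1 - Complex.I) ^ 2 = -2 * Complex.I := by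
  have : Complex.I * Complex.I = -1 := Complex.I_mul_I
  ring_nf
  rw [Complex.I_sq]
  ring

/-- **The germ cells are calibrated with `η²`-phase `(−2i)ⁿ`.** For an antidiagonal frame,
`η(L)² = (det U)² · (−2i)ⁿ` — a non-negative real multiple of `(−2i)ⁿ`.
[cite: Zharkov2020TropicalWeil, §2 (pp. 2–4)] -/
theorem sq_frameComplexDet_antidiagonal (L : Matrix (Fin (2 * n)) (Fin n) ℤ)
    (U : Matrix (Fin n) (Fin n) ℝ)
    (hx : ∀ k j : Fin n, ((L ⟨(k : ℕ), by omega⟩ j : ℤ) : ℝ) = U k j)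
    (hy : ∀ k j : Fin n, ((L ⟨(k : ℕ) + n, by omega⟩ j : ℤ) : ℝ) = -U k j) :
    frameComplexDet n L ^ 2 = ((U.det ^ 2 : ℝ) : ℂ) * (-2 * Complex.I) ^ n := by
  rw [frameComplexDet_antidiagonal L U hx hy, mul_pow, ← pow_mul, mul_comm n 2, pow_mul, one_sub_I_sq]
  push_cast
  ring

/-- `(−2i)² = −4`: at `n = 2` the germ phase is `−1` (van Geemen's bulk cells, `W = −μ`). [folklore] -/
theorem neg_two_mul_I_pow_two : (-2 * Complex.I) ^ 2 = -4 := by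
  have : Complex.I ^ 2 = -1 := Complex.I_sq
  linear_combination (4 : ℂ) * this

/-- `(−2i)³ = 8i`: at `n = 3` the germ phase is `+i`. [folklore] -/
theorem neg_two_mul_I_pow_three : (-2 * Complex.I) ^ 3 = 8 * Complex.I := by
  have : Complex.I ^ 2 = -1 := Complex.I_sq
  linear_combination (-8 * Complex.I) * this

/-- `(−2i)⁴ = 16`: at `n = 4` the germ phase is `+1` (K1-SCOPE §8b (2): the n = 4 germ is a phase-(+1)
excess-11 cell). [folklore] -/
theorem neg_two_mul_I_pow_four : (-2 * Complex.I) ^ 4 = 16 := by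
  have h : Complex.I ^ 2 = -1 := Complex.I_sq
  have : Complex.I ^ 4 = 1 := by
    rw [show (4 : ℕ) = 2 * 2 from rfl, pow_mul, h]; norm_num
  linear_combination (16 : ℂ) * this

end Summit.HodgeConjecture.HodgeConjecture.Theorems.TropicalWeilVanishing.SplitGerm

end
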